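import Summits.ResolutionOfSingularities.ResolutionOfSingularities.Theorems.FrobeniusLadderFInjectiveMacaulayficationFedderOrigin
import Summits.ResolutionOfSingularities.ResolutionOfSingularities.Theorems.FrobeniusLadderFInjectiveMacaulayficationE8ChartYPoints
import HarnessLib

/-!
# The `y`-chart of `Bl_𝔪(E₈⁰)` violates the clause at its origin in characteristic 3

Support file for crux stmt-ResolutionOfSingularities-15315
(`FrobeniusLadder.FInjectiveMacaulayfication`, line `Sketch`, seat c5, cycle 6, wave 2): stub
`stub_e8ChartYOriginNotClauseChar3` of the CALIBRATION package — the characteristic-`3` counterpart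
of `E8Char5.e7_chart_point_clause_char5` / `E8ChartYPoints.stub_e8ChartYPoints`, going the other way.

Let `k` be a field of characteristic `3`, `S = k[X₀, X₁, X₂]`, `P = (X₀, X₁, X₂)` and
`g_y = X₂² + X₁X₀³ + X₁³` — the strict transform of `E₈⁰ : z² + x³ + y⁵` on the `y`-chart of the
point blow-up (`E8Char5.e8_strictTransform_chart_y` up to renaming), an `E₇⁰`-type point at the
origin. Fedder's test at the origin (`Fedder.fedder_criterion_origin`, an iff) says that the
hypersurface local ring `S_P/(g_y)` satisfies the per-stalk clause of the crux (all systems of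
parameters weakly regular, all parameter ideals Frobenius closed) iff `g_y^(p-1) ∉ (X₀^p, X₁^p, X₂^p)`.
In characteristic `3`,

  `g_y² = X₂·X₂³ + (2X₂²X₁ + X₁²X₀³ + 2X₁⁴)·X₀³ + (2X₂² + X₁³)·X₁³ ∈ (X₀³, X₁³, X₂³)`

(`gy_sq_eq`, `gy_sq_mem`; every monomial of `g_y²` has an exponent `≥ 3`), so the clause FAILS at
`S_P/(g_y)` (`stub_e8ChartYOriginNotClauseChar3`): in characteristic `3` the point blow-up of `E₈⁰`
does not F-injectivize it in one step (contrast the characteristic-`5` calibration, where it does).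

References: [Fedder1983] R. Fedder, F-purity and rational singularity, Trans. AMS 278 (1983),
Prop. 1.7 and Thm. 1.12; M. Artin, Coverings of the rational double points in characteristic `p`
(1977) for the forms `E₈⁰`, `E₇⁰` (folklore).
-/

-- single-problem summit: the doubled namespace component is forced
set_option linter.dupNamespace false

namespace Summit.ResolutionOfSingularities.ResolutionOfSingularities.Theorems.FInjectiveMacaulayfication.E8ChartYOriginNotClauseChar3

open MvPolynomial
open Summit.ResolutionOfSingularities.ResolutionOfSingularities.Theorems.FInjectiveMacaulayfication

/-- **Fedder's cofactors for `g_y = X₂² + X₁X₀³ + X₁³` at exponent `2 = 3 - 1`:**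
`g_y² = (2X₂²X₁ + X₁²X₀³ + 2X₁⁴)·X₀³ + (2X₂² + X₁³)·X₁³ + X₂·X₂³` over any commutative ring
(a polynomial identity, `ring`). [folklore] -/
theorem gy_sq_eq (k : Type) [CommRing k] :
    (X 2 ^ 2 + X 1 * X 0 ^ 3 + X 1 ^ 3 : MvPolynomial (Fin 3) k) ^ 2 =
      (2 * X 2 ^ 2 * X 1 + X 1 ^ 2 * X 0 ^ 3 + 2 * X 1 ^ 4) * X 0 ^ 3 +
        (2 * X 2 ^ 2 + X 1 ^ 3) * X 1 ^ 3 + X 2 * X 2 ^ 3 := by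
  ring

/-- **`g_y` fails Fedder's test at `p = 3`:** `g_y² ∈ (X₀³, X₁³, X₂³)` for `g_y = X₂² + X₁X₀³ + X₁³`,
over any commutative ring — every monomial of `g_y²` has an exponent `≥ 3` (explicit cofactors,
`gy_sq_eq`). [cite: Fedder1983, Prop. 1.7] -/
theorem gy_sq_mem (k : Type) [CommRing k] :
    (X 2 ^ 2 + X 1 * X 0 ^ 3 + X 1 ^ 3 : MvPolynomial (Fin 3) k) ^ 2 ∈
      Ideal.span (Set.range fun i : Fin 3 => (X i : MvPolynomial (Fin 3) k) ^ 3) := by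
  have hX : ∀ i : Fin 3, (X i : MvPolynomial (Fin 3) k) ^ 3 ∈
      Ideal.span (Set.range fun i : Fin 3 => (X i : MvPolynomial (Fin 3) k) ^ 3) :=
    fun i => Ideal.subset_span ⟨i, rfl⟩
  rw [gy_sq_eq]
  exact add_mem (add_mem (Ideal.mul_mem_left _ _ (hX 0)) (Ideal.mul_mem_left _ _ (hX 1)))
    (Ideal.mul_mem_left _ _ (hX 2))

/-- **The `E₇⁰`-type point of the `y`-chart of `Bl_𝔪 E₈⁰` violates the crux's clause in
characteristic 3** (local-ring level). For a field `k` of characteristic `3`, `S = k[X₀, X₁, X₂]`,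
`P = (X₀, X₁, X₂)` and `g_y = X₂² + X₁X₀³ + X₁³`, the hypersurface local ring `S_P/(g_y)` does NOT
satisfy "every system of parameters is weakly regular and every parameter ideal is Frobenius closed"
(it is Cohen–Macaulay but not F-injective): Fedder's test at the origin
(`Fedder.fedder_criterion_origin`, an iff) reduces the clause to `g_y^(3-1) ∉ (X₀³, X₁³, X₂³)`, and
`g_y² ∈ (X₀³, X₁³, X₂³)` (`gy_sq_mem`). [cite: Fedder1983, Thm. 1.12] -/
theorem stub_e8ChartYOriginNotClauseChar3 : ∀ (k : Type) [Field k] [CharP k 3]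
    (P : Ideal (MvPolynomial (Fin 3) k)) [P.IsMaximal],
    P = Ideal.span (Set.range (MvPolynomial.X : Fin 3 → MvPolynomial (Fin 3) k)) →
    ¬ (∀ d : ℕ, ringKrullDim (Localization.AtPrime P ⧸ Ideal.span {algebraMap (MvPolynomial (Fin 3) k)
        (Localization.AtPrime P) (MvPolynomial.X 2 ^ 2 + MvPolynomial.X 1 * MvPolynomial.X 0 ^ 3 +
          MvPolynomial.X 1 ^ 3)}) = d →
      ∀ s : Fin d → Localization.AtPrime P ⧸ Ideal.span {algebraMap (MvPolynomial (Fin 3) k)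
        (Localization.AtPrime P) (MvPolynomial.X 2 ^ 2 + MvPolynomial.X 1 * MvPolynomial.X 0 ^ 3 +
          MvPolynomial.X 1 ^ 3)},
        Ideal.IsMaximal (Ideal.radical (Ideal.span (Set.range s))) →
          RingTheory.Sequence.IsWeaklyRegular (Localization.AtPrime P ⧸ Ideal.span {algebraMap
            (MvPolynomial (Fin 3) k) (Localization.AtPrime P) (MvPolynomial.X 2 ^ 2 +
              MvPolynomial.X 1 * MvPolynomial.X 0 ^ 3 + MvPolynomial.X 1 ^ 3)}) (List.ofFn s) ∧
          ∀ y : Localization.AtPrime P ⧸ Ideal.span {algebraMap (MvPolynomial (Fin 3) k)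
            (Localization.AtPrime P) (MvPolynomial.X 2 ^ 2 + MvPolynomial.X 1 * MvPolynomial.X 0 ^ 3 +
              MvPolynomial.X 1 ^ 3)},
            (∃ e : ℕ, y ^ 3 ^ e ∈ Ideal.span ((fun z : Localization.AtPrime P ⧸ Ideal.span {algebraMap
              (MvPolynomial (Fin 3) k) (Localization.AtPrime P) (MvPolynomial.X 2 ^ 2 +
                MvPolynomial.X 1 * MvPolynomial.X 0 ^ 3 + MvPolynomial.X 1 ^ 3)} => z ^ 3 ^ e) ''
              (Ideal.span (Set.range s) : Set (Localization.AtPrime P ⧸ Ideal.span {algebraMap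
                (MvPolynomial (Fin 3) k) (Localization.AtPrime P) (MvPolynomial.X 2 ^ 2 +
                  MvPolynomial.X 1 * MvPolynomial.X 0 ^ 3 + MvPolynomial.X 1 ^ 3)})))) →
            y ∈ Ideal.span (Set.range s)) := by
  intro k _ _ P _ hP
  haveI : Fact (Nat.Prime 3) := ⟨Nat.prime_three⟩
  obtain ⟨hgP, hg0⟩ := E8ChartYPoints.gy_mem_and_ne_zero k
  rw [← hP] at hgP
  rw [Fedder.fedder_criterion_origin 3 k 3 P hP _ hgP hg0, not_not]
  exact gy_sq_mem k

end Summit.ResolutionOfSingularities.ResolutionOfSingularities.Theorems.FInjectiveMacaulayfication.E8ChartYOriginNotClauseChar3
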